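import Summits.CriticalPhenomena.PercolationContinuityZ3.Theorems.Transplant.FKConnectivityAllQForestNearTightPinnedEars
import HarnessLib

/-!
# Near-tight gadgets with PINNED inside pairs: the type-I ear lemma and "first toggle invalid ⇒ second toggle valid"

Support file (`--supports stmt-CriticalPhenomena-4575`), FK sub-lane `prim-bschramm-fk-1` (gen 22) of the post-continuity programme;
builds on p205010 (kernel theorem, internal audit signed; external expert review pending).  No definitions, no named facts, no sorries;
standard axioms.  Part 2 of 3 of the PINNED EARS THEOREM: **`ears_typeI_pinned`** (verbatim `ears_typeI` with `E ⊆ M` weakened to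
`e, f, r, t ∈ M`) and **`ears_iota_valid_pinned`** (via `nearTight_dichotomy_of_fibre`).
[cite: Grimmett2006, §1.5 (p. 13)] [cite: Linusson2011, Prop. 2.6] [cite: SempleWelsh2008, Conj. 1.1 (p. 2)]
-/

noncomputable section

namespace Summit.CriticalPhenomena.PercolationContinuityZ3.Theorems
namespace FK

open Set Literature.Probability.LatticeModels Literature.Probability.Percolation
open scoped Classical symmDiff

variable {V : Type*} [Fintype V]

section PinnedEarsValid

variable {M u₀ : BondConfig V} {U : Finset V} {E : Finset (Sym2 V)} {o v v' y' y : V}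

variable (hd : Disjoint u₀ M) (hEMu : ∀ g ∈ E, g ∈ M ∨ g ∈ u₀) (hEU : ∀ g ∈ E, ∀ w ∈ g, w ∈ U)
  (hcard : 2 * U.card ≤ (E.filter fun g => g ∈ M).card + 2 * (E.filter fun g => g ∈ u₀).card + 3)
  (heE : s(o, v) ∈ E) (hfE : s(o, y) ∈ E) (hrE : s(v, v') ∈ E) (htE : s(y', y) ∈ E)
  (hve : ∀ g ∈ E, v ∈ g → g = s(o, v) ∨ g = s(v, v')) (hye : ∀ g ∈ E, y ∈ g → g = s(o, y) ∨ g = s(y', y))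
  (hov : o ≠ v) (hoy : o ≠ y) (hvy : v ≠ y) (hvv' : v ≠ v') (hyy' : y ≠ y') (hv'y : v' ≠ y) (hvy' : v ≠ y')
include hd hEMu hEU hcard heE hfE hrE htE hve hye hov hoy hvy hvv' hyy' hv'y hvy'

omit [Fintype V] hd hEMu hcard in
/-- **Type I** (`A ∩ E` joins `U` pairwise, `B ∩ E` joins two of any three): if `r ∈ B` then `v ↮ v'` in `A − e`; and if
`r ∈ A` or `o ~ v` in `B − r` (the first toggle is invalid) then `t ∈ B`, `y' ↮ y` in `A − f` and `o ↮ y` in `B − t` (the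
second toggle is valid). [cite: Grimmett2006, §1.5 (p. 13)] [cite: Linusson2011, Prop. 2.6] -/
theorem ears_typeI_pinned {ω : BondConfig V} (heM : s(o, v) ∈ M) (hfM : s(o, y) ∈ M) (hrM : s(v, v') ∈ M)
    (htM : s(y', y) ∈ M) (hA : IsForestCfg ω) (hB : IsForestCfg (ω ∆ M)) (he : s(o, v) ∈ ω) (hf : s(o, y) ∈ ω)
    (hconn : ∀ p ∈ U, ∀ q ∈ U, (openGraph (ω ∩ ↑E)).Reachable p q)
    (hthree : ∀ p ∈ U, ∀ q ∈ U, ∀ w ∈ U, (openGraph ((ω ∆ M) ∩ ↑E)).Reachable p q ∨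
      (openGraph ((ω ∆ M) ∩ ↑E)).Reachable p w ∨ (openGraph ((ω ∆ M) ∩ ↑E)).Reachable q w) :
    (s(v, v') ∉ ω → ¬ (openGraph (ω \ {s(o, v)})).Reachable v v') ∧
      (s(v, v') ∈ ω ∨ (openGraph ((ω ∆ M) \ {s(v, v')})).Reachable o v →
        s(y', y) ∉ ω ∧ ¬ (openGraph (ω \ {s(o, y)})).Reachable y' y ∧ ¬ (openGraph ((ω ∆ M) \ {s(y', y)})).Reachable o y) := by
  obtain ⟨hoU, hvU, hv'U, hy'U, hyU⟩ := ears_mem_U hEU heE hfE hrE htE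
  have hxB : ∀ {g : Sym2 V}, g ∈ M → (g ∈ ω ∆ M ↔ g ∉ ω) := fun hg => mem_symmDiff_iff_not_mem hg
  have heB : s(o, v) ∉ ω ∆ M := fun h => (hxB heM).1 h he
  have hfB : s(o, y) ∉ ω ∆ M := fun h => (hxB hfM).1 h hf
  have hrt := ears_r_ne_t (v' := v') (y' := y') hvy hvy'
  have hef : s(o, v) ≠ s(o, y) := fun h' => hvy (Sym2.congr_right.1 h')
  -- no cycle through a present pair
  have hcyc : ∀ {X : BondConfig V} {a b : V}, IsForestCfg X → a ≠ b → s(a, b) ∈ X →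
      ¬ (openGraph (X \ {s(a, b)})).Reachable a b := fun {X a b} hX hab hz => by
    have hback : insert s(a, b) (X \ {s(a, b)}) = X := by rw [insert_sdiff_singleton, insert_eq_of_mem hz]
    have hX' : IsForestCfg (insert s(a, b) (X \ {s(a, b)})) := by rwa [hback]
    exact ((isForestCfg_insert_iff hab fun h' => h'.2 rfl).1 hX').2
  -- V1: `r ∈ B ⇒ v ↮ v'` in `A − e` (`v` is a leaf of the spanning class `A ∩ E`, hanging at `o`)
  have hV1 : s(v, v') ∉ ω → ¬ (openGraph (ω \ {s(o, v)})).Reachable v v' := fun hr h => by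
    have hleaf : ∀ g ∈ ω ∩ (↑E : Set (Sym2 V)), v ∈ g → g = s(v, o) := fun g hg hvg => by
      rcases hve g hg.2 hvg with h' | rfl
      · rw [h', Sym2.eq_swap]
      · exact absurd hg.1 hr
    have h1 := not_reachable_of_conn_leaf hA hconn hoU hv'U hov.symm hvv' hleaf (by rw [Sym2.eq_swap]; exact he)
    rw [Sym2.eq_swap (a := v) (b := o)] at h1
    exact h1 h.symm
  refine ⟨hV1, fun hinv => ?_⟩
  -- the leaf `y` of `A ∩ E`: once `t ∉ A`, `y' ↮ y` in `A − f`
  have hV3 : s(y', y) ∉ ω → ¬ (openGraph (ω \ {s(o, y)})).Reachable y' y := fun ht h => by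
    have hleaf : ∀ g ∈ ω ∩ (↑E : Set (Sym2 V)), y ∈ g → g = s(y, o) := fun g hg hyg => by
      rcases hye g hg.2 hyg with h' | rfl
      · rw [h', Sym2.eq_swap]
      · exact absurd hg.1 ht
    have h1 := not_reachable_of_conn_leaf hA hconn hoU hy'U hoy.symm hyy' hleaf (by rw [Sym2.eq_swap]; exact hf)
    rw [Sym2.eq_swap (a := y) (b := o)] at h1
    exact h1 h
  -- leaves of `F = B ∩ E`
  have hleafyB : ∀ g ∈ (ω ∆ M) ∩ (↑E : Set (Sym2 V)), y ∈ g → g = s(y, y') := fun g hg hyg => by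
    rcases hye g hg.2 hyg with rfl | h'
    · exact absurd hg.1 hfB
    · rw [h', Sym2.eq_swap]
  have hleafvB : ∀ g ∈ (ω ∆ M) ∩ (↑E : Set (Sym2 V)), v ∈ g → g = s(v, v') := fun g hg hvg => by
    rcases hve g hg.2 hvg with rfl | h'
    · exact absurd hg.1 heB
    · exact h'
  rcases em (s(v, v') ∈ ω) with hr | hr
  · -- `r ∈ A`: `v` is isolated in `F`, so `F` joins the other vertices of `U` pairwise
    have hisov : ∀ g ∈ (ω ∆ M) ∩ (↑E : Set (Sym2 V)), v ∉ g := fun g hg hvg => by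
      rcases hve g hg.2 hvg with rfl | rfl
      · exact heB hg.1
      · exact (hxB hrM).1 hg.1 hr
    -- `t ∈ B`: else `y` is isolated too, and `o, v, y` are three components
    have ht : s(y', y) ∉ ω := fun ht => by
      have hisoy : ∀ g ∈ (ω ∆ M) ∩ (↑E : Set (Sym2 V)), y ∉ g := fun g hg hyg => by
        rcases hye g hg.2 hyg with rfl | rfl
        · exact hfB hg.1
        · exact (hxB htM).1 hg.1 ht
      exact hoy (eq_of_isolated_of_reachable hisoy (reachable_of_three_isolated hthree hvU hyU hoU hvy hov.symm hisov)).symm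
    have htB : s(y, y') ∈ ω ∆ M := by rw [Sym2.eq_swap]; exact (hxB htM).2 ht
    refine ⟨ht, hV3 ht, fun h => ?_⟩
    -- `o ~ y'` in `F` (as `v` is isolated), off the leaf pair `t`; then `y' ~ y` off `t` closes a cycle
    have h1 : (openGraph ((ω ∆ M) ∩ ↑E)).Reachable o y' := reachable_of_three_isolated hthree hvU hoU hy'U hov.symm hvy' hisov
    have h2 := reachable_sdiff_of_leaf hleafyB hoy.symm hyy' h1
    rw [Sym2.eq_swap (a := y) (b := y')] at h2
    have h3 : (openGraph ((ω ∆ M) \ {s(y', y)})).Reachable o y' :=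
      h2.mono (openGraph_mono (sdiff_subset_sdiff_left inter_subset_left))
    exact hcyc hB hyy'.symm ((hxB htM).2 ht) (h3.symm.trans h)
  · -- `r ∈ B` and (by invalidity) `o ~ v` in `B − r`
    have hov_r : (openGraph ((ω ∆ M) \ {s(v, v')})).Reachable o v := hinv.resolve_left hr
    have hrB : s(v, v') ∈ ω ∆ M := (hxB hrM).2 hr
    -- `o ↮ v'` in `F` (else off the leaf pair `r`, and `v ~ o ~ v'` in `B − r`)
    have hc1 : ¬ (openGraph ((ω ∆ M) ∩ ↑E)).Reachable o v' := fun h => by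
      have h2 := reachable_sdiff_of_leaf hleafvB hov.symm hvv' h
      have h3 : (openGraph ((ω ∆ M) \ {s(v, v')})).Reachable o v' :=
        h2.mono (openGraph_mono (sdiff_subset_sdiff_left inter_subset_left))
      exact hcyc hB hvv' hrB (hov_r.symm.trans h3)
    -- `t ∈ B`: else `y` is isolated in `F` and `F` joins `o, v'`
    have ht : s(y', y) ∉ ω := fun ht => by
      have hisoy : ∀ g ∈ (ω ∆ M) ∩ (↑E : Set (Sym2 V)), y ∉ g := fun g hg hyg => by
        rcases hye g hg.2 hyg with rfl | rfl
        · exact hfB hg.1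
        · exact (hxB htM).1 hg.1 ht
      exact hc1 (reachable_of_three_isolated hthree hyU hoU hv'U hoy.symm hv'y.symm hisoy)
    have htB : s(y', y) ∈ ω ∆ M := (hxB htM).2 ht
    refine ⟨ht, hV3 ht, fun hoy_t => ?_⟩
    -- `o ↮ y'` in `F` (symmetric to `hc1`)
    have hc3 : ¬ (openGraph ((ω ∆ M) ∩ ↑E)).Reachable o y' := fun h => by
      have h2 := reachable_sdiff_of_leaf hleafyB hoy.symm hyy' h
      rw [Sym2.eq_swap (a := y) (b := y')] at h2
      have h3 : (openGraph ((ω ∆ M) \ {s(y', y)})).Reachable o y' :=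
        h2.mono (openGraph_mono (sdiff_subset_sdiff_left inter_subset_left))
      exact hcyc hB hyy'.symm htB (h3.symm.trans hoy_t)
    -- `o ↮ v`, `o ↮ y` in `F`
    have hc2 : ¬ (openGraph ((ω ∆ M) ∩ ↑E)).Reachable o v := fun h =>
      hc1 (h.trans (reach_of_mem (ω := (ω ∆ M) ∩ ↑E) ⟨hrB, hrE⟩ hvv'))
    have hc4 : ¬ (openGraph ((ω ∆ M) ∩ ↑E)).Reachable o y := fun h =>
      hc3 (h.trans (reach_of_mem (ω := (ω ∆ M) ∩ ↑E) ⟨htB, htE⟩ hyy'.symm).symm)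
    -- so `v ~ y` in `F`, and `v' ~ y'` off both ear rims
    have hc5 : (openGraph ((ω ∆ M) ∩ ↑E)).Reachable v y := by
      rcases hthree o hoU v hvU y hyU with h | h | h
      · exact absurd h hc2
      · exact absurd h hc4
      · exact h
    have hc6 : (openGraph ((((ω ∆ M) ∩ ↑E) \ {s(v, v')}) \ {s(y', y)})).Reachable v' y' := by
      have hisov : ∀ g ∈ ((ω ∆ M) ∩ (↑E : Set (Sym2 V))) \ {s(v, v')}, v ∉ g := fun g hg hvg =>
        hg.2 (hleafvB g hg.1 hvg)
      have hback : insert s(v, v') (((ω ∆ M) ∩ ↑E) \ {s(v, v')}) = (ω ∆ M) ∩ ↑E := by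
        rw [insert_sdiff_singleton, insert_eq_of_mem (show s(v, v') ∈ (ω ∆ M) ∩ ↑E from ⟨hrB, hrE⟩)]
      rw [← hback, KNSep.reachable_insert_iff] at hc5
      have h1 : (openGraph (((ω ∆ M) ∩ ↑E) \ {s(v, v')})).Reachable v' y := by
        rcases hc5 with h | ⟨-, h⟩ | ⟨h, -⟩
        · exact absurd (eq_of_isolated_of_reachable hisov h) hvy
        · exact h
        · exact absurd (eq_of_isolated_of_reachable hisov h) hvv'
      have hisoy : ∀ g ∈ (((ω ∆ M) ∩ (↑E : Set (Sym2 V))) \ {s(v, v')}) \ {s(y', y)}, y ∉ g := fun g hg hyg =>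
        hg.2 (mem_singleton_iff.2 (by rw [hleafyB g hg.1.1 hyg, Sym2.eq_swap]))
      have htin : s(y', y) ∈ ((ω ∆ M) ∩ ↑E) \ {s(v, v')} := ⟨⟨htB, htE⟩, hrt.symm⟩
      have hback' : insert s(y', y) ((((ω ∆ M) ∩ ↑E) \ {s(v, v')}) \ {s(y', y)}) = ((ω ∆ M) ∩ ↑E) \ {s(v, v')} := by
        rw [insert_sdiff_singleton, insert_eq_of_mem htin]
      rw [← hback', KNSep.reachable_insert_iff] at h1
      rcases h1 with h | ⟨h, -⟩ | ⟨h, -⟩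
      · exact absurd (eq_of_isolated_of_reachable hisoy h.symm) hv'y.symm
      · exact h
      · exact absurd (eq_of_isolated_of_reachable hisoy h.symm) hv'y.symm
    -- transport to `W = (B − r) − t`
    have hWsub : (((ω ∆ M) ∩ (↑E : Set (Sym2 V))) \ {s(v, v')}) \ {s(y', y)} ⊆ ((ω ∆ M) \ {s(v, v')}) \ {s(y', y)} :=
      sdiff_subset_sdiff_left (sdiff_subset_sdiff_left inter_subset_left)
    have hW : (openGraph (((ω ∆ M) \ {s(v, v')}) \ {s(y', y)})).Reachable v' y' := hc6.mono (openGraph_mono hWsub)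
    have hW1 : ((ω ∆ M) \ {s(v, v')}) \ {s(y', y)} ⊆ (ω ∆ M) \ {s(v, v')} := sdiff_subset
    have hW2 : ((ω ∆ M) \ {s(v, v')}) \ {s(y', y)} ⊆ (ω ∆ M) \ {s(y', y)} := by
      rw [Set.sdiff_sdiff_comm]; exact sdiff_subset
    have hno_vv : ¬ (openGraph ((ω ∆ M) \ {s(v, v')})).Reachable v v' := hcyc hB hvv' hrB
    have hno_yy : ¬ (openGraph ((ω ∆ M) \ {s(y', y)})).Reachable y' y := hcyc hB hyy'.symm htB
    have htin' : s(y', y) ∈ (ω ∆ M) \ {s(v, v')} := ⟨htB, hrt.symm⟩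
    have hrin' : s(v, v') ∈ (ω ∆ M) \ {s(y', y)} := ⟨hrB, hrt⟩
    -- decompose `o ~ v` in `B − r` along `t`
    have hbackr : insert s(y', y) (((ω ∆ M) \ {s(v, v')}) \ {s(y', y)}) = (ω ∆ M) \ {s(v, v')} := by
      rw [insert_sdiff_singleton, insert_eq_of_mem htin']
    have hov_r' := hov_r
    rw [← hbackr, KNSep.reachable_insert_iff] at hov_r'
    rcases hov_r' with h | ⟨h, -⟩ | ⟨-, h⟩
    · -- (α) `o ~ v` in `W`: decompose `o ~ y` in `B − t` along `r`
      have hbackt : insert s(v, v') (((ω ∆ M) \ {s(v, v')}) \ {s(y', y)}) = (ω ∆ M) \ {s(y', y)} := by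
        rw [Set.sdiff_sdiff_comm, insert_sdiff_singleton, insert_eq_of_mem hrin']
      have hoy_t' := hoy_t
      rw [← hbackt, KNSep.reachable_insert_iff] at hoy_t'
      rcases hoy_t' with h' | ⟨-, h'⟩ | ⟨h', -⟩
      · -- (α') `v' ~ y' — y ~ o ~ v` in `B − r`
        have h5 : (openGraph ((ω ∆ M) \ {s(v, v')})).Reachable y' y := reach_of_mem htin' hyy'.symm
        exact hno_vv ((((hW.mono (openGraph_mono hW1)).trans h5).trans (h'.mono (openGraph_mono hW1)).symm).trans
          (h.mono (openGraph_mono hW1))).symm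
      · -- (β') `y' ~ v' ~ y` in `W ⊆ B − t`
        exact hno_yy ((hW.symm.trans h').mono (openGraph_mono hW2))
      · -- (γ') `v ~ o ~ v'` in `W ⊆ B − r`
        exact hno_vv ((h.symm.trans h').mono (openGraph_mono hW1))
    · -- (β) `o ~ y' ~ v'` in `W`, `v ~ o` in `B − r`
      exact hno_vv (hov_r.symm.trans ((h.trans hW.symm).mono (openGraph_mono hW1)))
    · -- (γ) `v' ~ y' ~ v` in `W`
      exact hno_vv ((hW.trans h).mono (openGraph_mono hW1)).symm

/-- **If the first toggle is invalid, the second one is valid**: for a bad fibre pair `(A, B) = (ω, ω ∆ M)` of forests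
(`e, f ∈ A`) on a near-tight gadget with ears at `v` and `y`, if NOT (`r ∈ B`, `v ↮ v'` in `A − e`, `o ↮ v` in `B − r`) then
`t ∈ B`, `y' ↮ y` in `A − f` and `o ↮ y` in `B − t`.  Proof: the dichotomy `nearTight_dichotomy`, then `ears_typeI` /
`ears_typeII`. [cite: Grimmett2006, §1.5 (p. 13)] [cite: Linusson2011, Prop. 2.6] [cite: SempleWelsh2008, Conj. 1.1 (p. 2)] -/
theorem ears_iota_valid_pinned {ω : BondConfig V} (heM : s(o, v) ∈ M) (hfM : s(o, y) ∈ M) (hrM : s(v, v') ∈ M)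
    (htM : s(y', y) ∈ M) (hω : ω \ M = u₀) (hA : IsForestCfg ω) (hB : IsForestCfg (ω ∆ M))
    (he : s(o, v) ∈ ω)
    (hf : s(o, y) ∈ ω)
    (hinv : ¬ (s(v, v') ∉ ω ∧ ¬ (openGraph (ω \ {s(o, v)})).Reachable v v' ∧
      ¬ (openGraph ((ω ∆ M) \ {s(v, v')})).Reachable o v)) :
    s(y', y) ∉ ω ∧ ¬ (openGraph (ω \ {s(o, y)})).Reachable y' y ∧ ¬ (openGraph ((ω ∆ M) \ {s(y', y)})).Reachable o y := by
  rcases nearTight_dichotomy_of_fibre (U := U) hd hω hEMu hEU hcard hA hB with ⟨hconn, hthree⟩ | ⟨hconn, hthree⟩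
  · obtain ⟨h1, h2⟩ :=
      ears_typeI_pinned hEU heE hfE hrE htE hve hye hov hoy hvy hvv' hyy' hv'y hvy' heM hfM hrM htM hA hB he hf hconn hthree
    refine h2 ?_
    by_cases hr : s(v, v') ∈ ω
    · exact Or.inl hr
    · refine Or.inr ?_
      by_contra hc
      exact hinv ⟨hr, h1 hr, hc⟩
  · obtain ⟨hr, ht, hU3, hU4, h5⟩ :=
      ears_typeII_pinned hEU heE hfE hrE htE hve hye hov hoy hvy hvv' hyy' hv'y hvy' heM hfM hrM htM hA hB he hf hconn hthree
    have hvv : (openGraph (ω \ {s(o, v)})).Reachable v v' := by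
      by_contra hc
      exact hinv ⟨hr, hc, hU3⟩
    exact ⟨ht, h5 hvv, hU4⟩


end PinnedEarsValid

end FK
end Summit.CriticalPhenomena.PercolationContinuityZ3.Theorems

end
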